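import Literature.AlgebraicGeometry.Frobenioids.CategoriesFactorization
import Literature.AlgebraicGeometry.Frobenioids.EquivalenceTransport
import Mathlib.CategoryTheory.Comma.Over.Basic
import Mathlib.CategoryTheory.Endomorphism
import Mathlib.CategoryTheory.Adjunction.Basic
import Mathlib.CategoryTheory.Functor.EpiMono
import Mathlib.Algebra.Group.Subgroup.Map
import HarnessLib

/-!
# Frobenioids I, §0/§3: the §0 dictionary is invariant under equivalences of categories

Mochizuki, *The geometry of Frobenioids I: the general theory*, Kyushu J. Math. **62** (2008),
§0 pp. 17–18 and the proof of Thm. 3.4 (i), kurims p. 63: "Since iso-subanchors are manifestly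
preserved by any equivalence of categories, it follows from our assumption that `C₁`, `C₂` are of
quasi-isotropic type that `Ψ` preserves isotropic objects" [cite: MochizukiFrdI2008, Thm. 3.4 (i) p.63].

This file continues `EquivalenceTransport.lean` (irreducible arrows, FSM-morphisms, categorical
quotients) with the notions that file leaves out: for an equivalence `e : C₁ ≌ C₂` (and, inside one
category, along isomorphisms of objects / of arrows) anchors, subanchors, MONO-MINIMAL categorical
quotients and iso-subanchors are preserved and reflected (`…_obj_iff`), irreducibility is reflected, and
arrows minimal-adjoint / minimal-coadjoint to a class of arrows are carried to arrows minimal-adjoint /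
minimal-coadjoint to any class whose `e.inverse`-images lie in the original class. Groups of
automorphisms are transported along `e.functor.mapAut` (`G ↦ G.map (e.functor.mapAut A)`), as in
`IsCategoricalQuotient.map_equivalence`. Proof-only (no new definitions); used by the proof of
Thm. 3.4 (i) ("`Ψ` preserves isotropic objects" for Frobenioids of quasi-isotropic type).
-/

-- Compositions with `e.unit.app _` / `e.unitInv.app _` have implicit objects `(𝟭 C).obj A`,
-- `(F ⋙ G).obj A`, which only unfold at default transparency (as in Mathlib's `Equivalence` files).
set_option backward.isDefEq.respectTransparency false

namespace Literature.AlgebraicGeometry.Frobenioids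

open CategoryTheory

universe v v₁ v₂ u u₁ u₂

section Equivalence

variable {C : Type u} [Category.{v} C]
variable {C₁ : Type u₁} [Category.{v₁} C₁] {C₂ : Type u₂} [Category.{v₂} C₂]

/-! ### Pulling a factorisation of `e.functor.map φ` back to a factorisation of `φ` -/

/-- A factorisation `e(φ) = β' ≫ α'` in `C₂` pulls back along the unit to a factorisation of `φ`.
[folklore] -/
private theorem fac_pullback (e : C₁ ≌ C₂) {A B : C₁} {X' : C₂} (β' : e.functor.obj A ⟶ X')
    (α' : X' ⟶ e.functor.obj B) {φ : A ⟶ B} (hfac : β' ≫ α' = e.functor.map φ) :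
    (e.unit.app A ≫ e.inverse.map β') ≫ (e.inverse.map α' ≫ e.unitInv.app B) = φ := by
  rw [Category.assoc, ← e.inverse.map_comp_assoc, hfac, e.inv_fun_map]
  simp

/-- If `e.unit.app A ≫ e.inverse.map β'` is an isomorphism then so is `β'`. [folklore] -/
private theorem isIso_of_isIso_unit_comp (e : C₁ ≌ C₂) {A : C₁} {X' : C₂}
    (β' : e.functor.obj A ⟶ X') (h : IsIso (e.unit.app A ≫ e.inverse.map β')) : IsIso β' := by
  haveI : IsIso (e.inverse.map β') := IsIso.of_isIso_comp_left (e.unit.app A) (e.inverse.map β')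
  exact isIso_of_fully_faithful e.inverse β'

/-- If `e.inverse.map α' ≫ e.unitInv.app B` is an isomorphism then so is `α'`. [folklore] -/
private theorem isIso_of_isIso_comp_unitInv (e : C₁ ≌ C₂) {B : C₁} {X' : C₂}
    (α' : X' ⟶ e.functor.obj B) (h : IsIso (e.inverse.map α' ≫ e.unitInv.app B)) : IsIso α' := by
  haveI : IsIso (e.inverse.map α') := IsIso.of_isIso_comp_right (e.inverse.map α') (e.unitInv.app B)
  exact isIso_of_fully_faithful e.inverse α'

/-! ### Irreducible arrows -/

/-- Irreducibility is invariant under isomorphism of arrows: if `φ ≫ j = i ≫ φ'` with `i`, `j`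
isomorphisms, then `φ` irreducible implies `φ'` irreducible. [cite: MochizukiFrdI2008, §0 p.17] -/
theorem IsIrreducibleHom.of_arrow_iso {A B A' B' : C} {φ : A ⟶ B} {φ' : A' ⟶ B'} (i : A ≅ A')
    (j : B ≅ B') (w : φ ≫ j.hom = i.hom ≫ φ') (h : IsIrreducibleHom φ) : IsIrreducibleHom φ' := by
  have hφ' : φ' = i.inv ≫ φ ≫ j.hom := by
    rw [w, Iso.inv_hom_id_assoc]
  refine ⟨fun hiso => h.1 ?_, fun X β α hβα => ?_⟩
  · have : φ = i.hom ≫ φ' ≫ j.inv := by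
      rw [hφ', Category.assoc, Category.assoc, Iso.hom_inv_id, Category.comp_id,
        Iso.hom_inv_id_assoc]
    rw [this]
    infer_instance
  · have hfac : (i.hom ≫ β) ≫ (α ≫ j.inv) = φ := by
      rw [Category.assoc, ← Category.assoc β, hβα, hφ', Category.assoc, Category.assoc,
        Iso.hom_inv_id, Category.comp_id, Iso.hom_inv_id_assoc]
    rcases h.2 (i.hom ≫ β) (α ≫ j.inv) hfac with hα | hβ
    · exact Or.inl (IsIso.of_isIso_comp_right α j.inv)
    · exact Or.inr (IsIso.of_isIso_comp_left i.hom β)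

/-- Irreducibility of an arrow is detected after applying an equivalence of categories.
[cite: MochizukiFrdI2008, §0 p.17] -/
theorem isIrreducibleHom_map_iff (e : C₁ ≌ C₂) {A B : C₁} (φ : A ⟶ B) :
    IsIrreducibleHom (e.functor.map φ) ↔ IsIrreducibleHom φ := by
  refine ⟨fun h => ?_, fun h => h.map_equivalence e⟩
  have h' : IsIrreducibleHom (e.inverse.map (e.functor.map φ)) := h.map_equivalence e.symm
  exact h'.of_arrow_iso (asIso (e.unitInv.app A)) (asIso (e.unitInv.app B))
    (by simp)

/-! ### Anchors and subanchors -/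

/-- Transfer of the anchor property along an essentially surjective functor of coslice categories
that reflects irreducibility of the structure arrows. [cite: MochizukiFrdI2008, §0 p.18] -/
theorem IsAnchor.of_under_functor {A : C₁} {A₂ : C₂} (P : Under A ⥤ Under A₂) [P.EssSurj]
    (hP : ∀ f : Under A, IsIrreducibleHom (P.obj f).hom → IsIrreducibleHom f.hom)
    (hA : IsAnchor A) : IsAnchor A₂ := by
  let q : Quotient (isIsomorphicSetoid (Under A)) → Quotient (isIsomorphicSetoid (Under A₂)) :=
    Quotient.map' P.obj fun f g ⟨i⟩ => ⟨P.mapIso i⟩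
  refine (hA.image q).subset ?_
  rintro x ⟨f₂, hf₂, rfl⟩
  let f : Under A := P.objPreimage f₂
  let i : P.obj f ≅ f₂ := P.objObjPreimageIso f₂
  refine ⟨⟦f⟧, ⟨f, hP f ?_, rfl⟩, Quotient.sound ⟨i⟩⟩
  exact hf₂.of_arrow_iso (Iso.refl A₂) ((Under.forget A₂).mapIso i.symm) (by simp)

/-- An equivalence of categories carries anchors to anchors. [cite: MochizukiFrdI2008, §0 p.18] -/
theorem IsAnchor.map_equivalence (e : C₁ ≌ C₂) {A : C₁} (hA : IsAnchor A) :
    IsAnchor (e.functor.obj A) :=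
  hA.of_under_functor (Under.post e.functor) fun f hf =>
    (isIrreducibleHom_map_iff e f.hom).1 hf

/-- The anchor property is invariant under isomorphism. [cite: MochizukiFrdI2008, §0 p.18] -/
theorem IsAnchor.of_iso {A A' : C} (i : A ≅ A') (hA : IsAnchor A) : IsAnchor A' :=
  hA.of_under_functor (Under.map i.inv) fun f hf => by
    rw [Under.map_obj_hom] at hf
    exact hf.of_arrow_iso i.symm (Iso.refl _) (by simp)

/-- The anchor property is detected after applying an equivalence. [cite: MochizukiFrdI2008, §0 p.18] -/
theorem isAnchor_obj_iff (e : C₁ ≌ C₂) (A : C₁) : IsAnchor (e.functor.obj A) ↔ IsAnchor A :=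
  ⟨fun h => (h.map_equivalence e.symm).of_iso (asIso (e.unitInv.app A)),
    fun h => h.map_equivalence e⟩

/-- An equivalence of categories carries subanchors to subanchors. [cite: MochizukiFrdI2008, §0 p.18] -/
theorem IsSubanchor.map_equivalence (e : C₁ ≌ C₂) {A : C₁} (hA : IsSubanchor A) :
    IsSubanchor (e.functor.obj A) := by
  obtain ⟨B, hB, ⟨f⟩⟩ := hA
  exact ⟨e.functor.obj B, hB.map_equivalence e, ⟨e.functor.map f⟩⟩

/-- The subanchor property is invariant under isomorphism. [cite: MochizukiFrdI2008, §0 p.18] -/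
theorem IsSubanchor.of_iso {A A' : C} (i : A ≅ A') (hA : IsSubanchor A) : IsSubanchor A' := by
  obtain ⟨B, hB, ⟨f⟩⟩ := hA
  exact ⟨B, hB, ⟨i.inv ≫ f⟩⟩

/-- The subanchor property is detected after applying an equivalence. [cite: MochizukiFrdI2008, §0 p.18] -/
theorem isSubanchor_obj_iff (e : C₁ ≌ C₂) (A : C₁) :
    IsSubanchor (e.functor.obj A) ↔ IsSubanchor A :=
  ⟨fun h => (h.map_equivalence e.symm).of_iso (asIso (e.unitInv.app A)),
    fun h => h.map_equivalence e⟩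

/-! ### Categorical quotients and mono-minimal quotients -/

/-- `F.mapAut` is injective for a faithful functor. [folklore] -/
private theorem mapAut_injective (F : C₁ ⥤ C₂) [F.Faithful] (A : C₁) :
    Function.Injective (F.mapAut A) := by
  intro x y hxy
  apply Iso.ext
  apply F.map_injective
  exact congrArg Iso.hom hxy

/-- A categorical quotient `φ : A → B` of `A` by `G` stays one after post-composition with an
isomorphism of `B`. [cite: MochizukiFrdI2008, §0 p.18] -/
theorem IsCategoricalQuotient.comp_iso {A B B' : C} {G : Subgroup (Aut A)} {φ : A ⟶ B}
    (h : IsCategoricalQuotient G φ) (j : B ≅ B') : IsCategoricalQuotient G (φ ≫ j.hom) := by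
  refine ⟨fun γ hγ => by rw [← Category.assoc, h.1 γ hγ], fun X ψ hψ => ?_⟩
  obtain ⟨ψ₀, hψ₀, huniq⟩ := h.2 ψ hψ
  refine ⟨j.inv ≫ ψ₀, by simpa using hψ₀, fun χ hχ => ?_⟩
  have : j.hom ≫ χ = ψ₀ := huniq _ (by simpa using hχ)
  rw [← this, Iso.inv_hom_id_assoc]

/-- A mono-minimal categorical quotient stays one after post-composition with an isomorphism.
[cite: MochizukiFrdI2008, §0 p.18] -/
theorem IsMonoMinimalQuotient.comp_iso {A B B' : C} {G : Subgroup (Aut A)} {φ : A ⟶ B}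
    (h : IsMonoMinimalQuotient G φ) (j : B ≅ B') : IsMonoMinimalQuotient G (φ ≫ j.hom) := by
  refine ⟨h.1.comp_iso j, fun A' ζ φ' hfac hmono hG => ?_⟩
  refine h.2 ζ (φ' ≫ j.inv) ?_ hmono hG
  rw [← Category.assoc, hfac, Category.assoc, Iso.hom_inv_id, Category.comp_id]

/-- An equivalence of categories carries a mono-minimal categorical quotient of `A` by `G` to a
mono-minimal categorical quotient of `e(A)` by `e(G)`. [cite: MochizukiFrdI2008, §0 p.18] -/
theorem IsMonoMinimalQuotient.map_equivalence (e : C₁ ≌ C₂) {A B : C₁} {G : Subgroup (Aut A)}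
    {φ : A ⟶ B} (h : IsMonoMinimalQuotient G φ) :
    IsMonoMinimalQuotient (G.map (e.functor.mapAut A)) (e.functor.map φ) := by
  refine ⟨h.1.map_equivalence e, fun A'' ζ' φ'' hfac hmono hG'' => ?_⟩
  obtain ⟨G'', e'', he''⟩ := hG''
  -- the pulled-back factorisation `φ = ζ ≫ φ'`, `ζ = η_A ≫ e⁻¹(ζ')`
  haveI : Mono ζ' := hmono
  haveI : Mono (e.unit.app A ≫ e.inverse.map ζ') := mono_comp _ _
  -- transport the group `G'' ⊆ Aut(A'')` to `Aut(e⁻¹(A''))`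
  have hinj₁ : Function.Injective (e.functor.mapAut A) := mapAut_injective e.functor A
  have hinj₂ : Function.Injective (e.inverse.mapAut A'') := mapAut_injective e.inverse A''
  let e' : G ≃* G''.map (e.inverse.mapAut A'') :=
    (G.equivMapOfInjective _ hinj₁).trans (e''.trans (G''.equivMapOfInjective _ hinj₂))
  have hcompat : ∀ γ : G, (γ : Aut A).hom ≫ (e.unit.app A ≫ e.inverse.map ζ') =
      (e.unit.app A ≫ e.inverse.map ζ') ≫
        ((e' γ : G''.map (e.inverse.mapAut A'')) : Aut (e.inverse.obj A'')).hom := by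
    intro γ
    have h1 : ((e' γ : G''.map (e.inverse.mapAut A'')) : Aut (e.inverse.obj A'')) =
        e.inverse.mapAut A'' ((e'' (G.equivMapOfInjective _ hinj₁ γ) : G'') : Aut A'') := by
      simp only [e', MulEquiv.trans_apply]
      exact Subgroup.coe_equivMapOfInjective_apply _ _ hinj₂ _
    have h2 := he'' (G.equivMapOfInjective _ hinj₁ γ)
    have h3 : ((G.equivMapOfInjective (e.functor.mapAut A) hinj₁ γ : G.map (e.functor.mapAut A)) :
        Aut (e.functor.obj A)) = e.functor.mapAut A (γ : Aut A) :=
      Subgroup.coe_equivMapOfInjective_apply _ _ hinj₁ _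
    rw [h3] at h2
    rw [h1]
    change (γ : Aut A).hom ≫ e.unit.app A ≫ e.inverse.map ζ' =
      (e.unit.app A ≫ e.inverse.map ζ') ≫ e.inverse.map (((e'' _ : G'') : Aut A'').hom)
    change e.functor.map (γ : Aut A).hom ≫ ζ' = ζ' ≫ _ at h2
    have hn := e.unit_naturality_assoc (γ : Aut A).hom (e.inverse.map ζ')
    rw [← e.inverse.map_comp, h2, e.inverse.map_comp] at hn
    exact hn.symm.trans (Category.assoc _ _ _).symm
  have hiso : IsIso (e.unit.app A ≫ e.inverse.map ζ') :=
    h.2 _ _ (fac_pullback e ζ' φ'' hfac) inferInstance ⟨_, e', hcompat⟩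
  exact isIso_of_isIso_unit_comp e ζ' hiso

/-! ### Iso-subanchors -/

/-- An equivalence of categories carries iso-subanchors to iso-subanchors ("iso-subanchors are
manifestly preserved by any equivalence of categories", FrdI proof of Thm. 3.4 (i) p. 63).
[cite: MochizukiFrdI2008, Thm. 3.4 (i) p.63] -/
theorem IsIsoSubanchor.map_equivalence (e : C₁ ≌ C₂) {A : C₁} (hA : IsIsoSubanchor A) :
    IsIsoSubanchor (e.functor.obj A) := by
  obtain ⟨B, G, f, hB, hf⟩ := hA
  exact ⟨e.functor.obj B, G.map (e.functor.mapAut B), e.functor.map f, hB.map_equivalence e,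
    hf.map_equivalence e⟩

/-- The iso-subanchor property is invariant under isomorphism. [cite: MochizukiFrdI2008, §0 p.18] -/
theorem IsIsoSubanchor.of_iso {A A' : C} (i : A ≅ A') (hA : IsIsoSubanchor A) :
    IsIsoSubanchor A' := by
  obtain ⟨B, G, f, hB, hf⟩ := hA
  exact ⟨B, G, f ≫ i.hom, hB, hf.comp_iso i⟩

/-- The iso-subanchor property is detected after applying an equivalence of categories.
[cite: MochizukiFrdI2008, Thm. 3.4 (i) p.63] -/
theorem isIsoSubanchor_obj_iff (e : C₁ ≌ C₂) (A : C₁) :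
    IsIsoSubanchor (e.functor.obj A) ↔ IsIsoSubanchor A :=
  ⟨fun h => (h.map_equivalence e.symm).of_iso (asIso (e.unitInv.app A)),
    fun h => h.map_equivalence e⟩

/-! ### Minimal-adjoint and minimal-coadjoint arrows -/

/-- An equivalence carries an arrow minimal-coadjoint to `S₁` to an arrow minimal-coadjoint to any
class `S₂` whose `e.inverse`-images lie in `S₁`, provided `S₁` is stable under post-composition with
isomorphisms. [cite: MochizukiFrdI2008, §0 p.17] -/
theorem IsMinimalCoadjoint.map_equivalence (e : C₁ ≌ C₂) {S₁ : MorphismProperty C₁}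
    {S₂ : MorphismProperty C₂} (hS : ∀ ⦃X Y : C₂⦄ (β : X ⟶ Y), S₂ β → S₁ (e.inverse.map β))
    (hS₁ : ∀ ⦃X Y Y' : C₁⦄ (β : X ⟶ Y) (j : Y ⟶ Y'), IsIso j → S₁ β → S₁ (β ≫ j))
    {A B : C₁} {φ : A ⟶ B} (h : IsMinimalCoadjoint S₁ φ) :
    IsMinimalCoadjoint S₂ (e.functor.map φ) := by
  intro X' α' β' hfac hβ'
  have hβ : S₁ (e.inverse.map β' ≫ e.unitInv.app B) := hS₁ _ _ inferInstance (hS β' hβ')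
  exact isIso_of_isIso_comp_unitInv e β' (h _ _ (fac_pullback e α' β' hfac) hβ)

/-- An equivalence carries an arrow minimal-adjoint to `S₁` to an arrow minimal-adjoint to any class
`S₂` whose `e.inverse`-images lie in `S₁`, provided `S₁` is stable under pre-composition with
isomorphisms. [cite: MochizukiFrdI2008, §0 p.17] -/
theorem IsMinimalAdjoint.map_equivalence (e : C₁ ≌ C₂) {S₁ : MorphismProperty C₁}
    {S₂ : MorphismProperty C₂} (hS : ∀ ⦃X Y : C₂⦄ (β : X ⟶ Y), S₂ β → S₁ (e.inverse.map β))
    (hS₁ : ∀ ⦃X X' Y : C₁⦄ (i : X' ⟶ X) (β : X ⟶ Y), IsIso i → S₁ β → S₁ (i ≫ β))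
    {A B : C₁} {φ : A ⟶ B} (h : IsMinimalAdjoint S₁ φ) :
    IsMinimalAdjoint S₂ (e.functor.map φ) := by
  intro X' β' α' hfac hβ'
  have hβ : S₁ (e.unit.app A ≫ e.inverse.map β') := hS₁ _ _ inferInstance (hS β' hβ')
  exact isIso_of_isIso_unit_comp e β' (h _ _ (fac_pullback e β' α' hfac) hβ)

/-- Minimal-coadjointness is invariant under isomorphism of arrows, for a class `S` stable under
post-composition with isomorphisms. [cite: MochizukiFrdI2008, §0 p.17] -/
theorem IsMinimalCoadjoint.of_arrow_iso {S : MorphismProperty C}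
    (hS : ∀ ⦃X Y Y' : C⦄ (β : X ⟶ Y) (j : Y ⟶ Y'), IsIso j → S β → S (β ≫ j))
    {A B A' B' : C} {φ : A ⟶ B} {φ' : A' ⟶ B'} (i : A ≅ A') (j : B ≅ B')
    (w : φ ≫ j.hom = i.hom ≫ φ') (h : IsMinimalCoadjoint S φ) : IsMinimalCoadjoint S φ' := by
  intro X α β hfac hβ
  have hfac' : (i.hom ≫ α) ≫ (β ≫ j.inv) = φ := by
    rw [Category.assoc, ← Category.assoc α, hfac, ← cancel_mono j.hom, Category.assoc,
      Category.assoc, Iso.inv_hom_id, Category.comp_id, w]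
  haveI := h (i.hom ≫ α) (β ≫ j.inv) hfac' (hS β j.inv inferInstance hβ)
  exact IsIso.of_isIso_comp_right β j.inv

/-- Minimal-adjointness is invariant under isomorphism of arrows, for a class `S` stable under
pre-composition with isomorphisms. [cite: MochizukiFrdI2008, §0 p.17] -/
theorem IsMinimalAdjoint.of_arrow_iso {S : MorphismProperty C}
    (hS : ∀ ⦃X X' Y : C⦄ (i : X' ⟶ X) (β : X ⟶ Y), IsIso i → S β → S (i ≫ β))
    {A B A' B' : C} {φ : A ⟶ B} {φ' : A' ⟶ B'} (i : A ≅ A') (j : B ≅ B')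
    (w : φ ≫ j.hom = i.hom ≫ φ') (h : IsMinimalAdjoint S φ) : IsMinimalAdjoint S φ' := by
  intro X β α hfac hβ
  have hfac' : (i.hom ≫ β) ≫ (α ≫ j.inv) = φ := by
    rw [Category.assoc, ← Category.assoc β, hfac, ← cancel_mono j.hom, Category.assoc,
      Category.assoc, Iso.inv_hom_id, Category.comp_id, w]
  haveI := h (i.hom ≫ β) (α ≫ j.inv) hfac' (hS i.hom β inferInstance hβ)
  exact IsIso.of_isIso_comp_left i.hom β

end Equivalence

end Literature.AlgebraicGeometry.Frobenioids
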